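import Literature.NumberTheory.EllipticCurves.ModularCurveEtaProductsProofs
import Literature.NumberTheory.EllipticCurves.ModularCurveGenusIntegralityProofs
import HarnessLib

/-!
# The genus-two levels `22` and `23`: `dim S₂(Γ₀(22)) = dim S₂(Γ₀(23)) = 2`, by oldforms and a
  Hecke translate of `η`-products; the levels at which `dim S₂(Γ₀(N)) = g(X₀(N))` is proved
  (trunk EllArithM, item C17; instances of the named fact `finrank_cuspForm_two_eq_genusX0`)

`ModularCurveGenusIntegralityProofs` reduces the named fact `finrank_cuspForm_two_eq_genusX0 N`
(`dim S₂(Γ₀(N)) = g(X₀(N))`, Diamond–Shurman Thm. 3.5.1) to the *existence* of `g(X₀(N))`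
linearly independent weight-`2` cusp forms for `Γ₀(N)` (`finrank_cuspForm_two_eq_genusX0_iff_le`:
the upper bound is Manin's, integrality is proved). This file supplies that existence at the two
levels of genus `2` below `26`, with cusp forms built from the closed-form multiplier of `η²`
(`ModularCurveEtaProductsProofs`: invariance by `decide` modulo `4` and `3`, vanishing at all cusps
by the Hermite decomposition) and told apart by their leading terms at `i∞`:

* `tendsto_eta_tprod_mul_atImInfty`: `η(aτ)/e^{2πi aτ/24} = ∏(1 - e^{2πi naτ}) → 1` as
  `Im τ → ∞`, the source of all leading terms below;
* level `22`: `cuspFormEtaProductElevenLevel22`, `cuspFormEtaProductTwentyTwo` — the oldforms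
  `φ_11(τ) = η(τ)²η(11τ)²` and `φ_11(2τ) = η(2τ)²η(22τ)²` in `S₂(Γ₀(22))` (images of
  Diamond–Shurman's `φ_11 ∈ S₂(Γ₀(11))`, Prop. 3.2.2, under the degeneracy maps `ι_1`, `ι_2` of
  §5.6), with leading terms `q` and `q²` (`tendsto_etaProductEleven_div_qParam`,
  `tendsto_etaProductTwentyTwo_div_qParam`), whence `linearIndependent_etaProducts_level22` and
  `finrank_cuspForm_two_eq_genusX0_twentyTwo`: **`dim S₂(Γ₀(22)) = g(X₀(22)) = 2`**,
  `S₂(Γ₀(22)) = ℂφ_11 ⊕ ℂφ_11(2τ)`;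
* level `23`: `cuspFormEtaProductTwentyThree` — `φ_23 = η(τ)²η(23τ)² ∈ S₂(Γ₀(23))` (the square
  of the weight-one form `η(τ)η(23τ)`), leading term `q²`; its Hecke translate `T₂ φ_23`
  (`heckeT` of `HeckeOperators`, made explicit by `coe_heckeT_gamma0_eq_sum`, Diamond–Shurman
  Prop. 5.2.1: `(T₂φ)(τ) = ½φ(τ/2) + ½φ((τ+1)/2) + 2φ(2τ)`) has leading term `q`
  (`tendsto_heckeT_two_etaProductTwentyThree_div_qParam`, i.e. `a_1(T₂φ_23) = a_2(φ_23) = 1`),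
  whence `linearIndependent_heckeT_etaProduct_level23` and
  `finrank_cuspForm_two_eq_genusX0_twentyThree`: **`dim S₂(Γ₀(23)) = g(X₀(23)) = 2`**,
  `S₂(Γ₀(23)) = ℂ T₂φ_23 ⊕ ℂ φ_23`;
* `finrank_cuspForm_two_eq_genusX0_of_mem_levels`: the named fact for
  `N ∈ {1, …, 13, 16, 18, 20, 22, 23, 25, 27, 32, 36}` (all genus-`0` levels, the `η²`-product
  genus-`1` levels, `22` and `23`), collecting `ModularCurveGenusBoundProofs`,
  `ModularCurveEtaProductsProofs` and this file; hence `twelve_mul_finrank_cuspForm_two (Γ₀(N))`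
  (`ModularCurveProofs`, Diamond–Shurman Thm. 3.1.1 with 3.5.1) and, given conjugation-stability,
  `Ω^±_f > 0` for rational newforms at these levels
  (`twelve_mul_finrank_cuspForm_two_gamma0_of_mem_levels`,
  `IsNewform0.plusPeriod_pos_and_minusPeriod_pos_of_mem_levels`).

Not covered: the genus-one levels `14, 15, 24` (their generators `η(τ)η(2τ)η(7τ)η(14τ)`, … are
`η`-quotients with odd exponents, needing the full `η`-multiplier of order `24`), `17, 19, 21, 49`
(no `η`-quotient), and genus `≥ 3` other than by the general theorem.

## References

* F. Diamond, J. Shurman, *A first course in modular forms*, GTM 228, Springer (2005), Thm. 3.5.1,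
  Prop. 3.2.2, Prop. 5.2.1, §5.6.

(Maintenance re-land 2026-08-20, no content change: refreshes this module's hub build after the
2026-08-17 binder repair of `ModularCurve.finrank_cuspForm_two_eq_genusX0`, so that the dependant
`ModularCurveEtaQuotientsProofs` can be repaired and verified.)
-/

noncomputable section

open UpperHalfPlane hiding I
open ModularForm Complex Matrix.SpecialLinearGroup Filter Asymptotics CongruenceSubgroup Function
open scoped MatrixGroups Real ModularForm CongruenceSubgroup Topology Manifold

namespace Literature.NumberTheory.EllipticCurves.ModularForms

/-! ### Asymptotics `η(aτ) ∼ e^{2πi aτ/24}` at `i∞` -/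

/-- `∏_{n ≥ 1} (1 - qⁿ) → 1` as `q → 0` (dominated convergence, as in Mathlib's
`tendsto_atImInfty_tprod_one_sub_eta_q_pow`). [folklore] -/
theorem tendsto_tprod_one_sub_pow_nhds_zero :
    Tendsto (fun q : ℂ ↦ ∏' n : ℕ, (1 - q ^ (n + 1))) (𝓝 0) (𝓝 1) := by
  have := tendsto_tprod_one_add_of_dominated_convergence (𝓕 := 𝓝 0) (g := 0)
    (f := fun (q : ℂ) (n : ℕ) ↦ -q ^ (n + 1)) (bound := fun n ↦ (1 / 2 : ℝ) ^ (n + 1))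
  simp only [Pi.zero_apply, norm_neg, norm_pow, add_zero, tprod_one] at this
  simp_rw [sub_eq_add_neg]
  refine this
    (by simpa only [pow_succ'] using (summable_geometric_of_abs_lt_one (by norm_num)).mul_left _)
    (fun k ↦ by simpa using ((continuous_pow (M := ℂ) (k + 1)).tendsto 0).neg) ?_
  filter_upwards [Metric.ball_mem_nhds (0 : ℂ) (by norm_num : (0 : ℝ) < 1 / 2)] with q hq k
  exact pow_le_pow_left₀ (norm_nonneg _) (mem_ball_zero_iff.mp hq).le _

/-- `e^{2πi aτ} → 0` as `Im τ → ∞` (`a > 0`). [folklore] -/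
theorem tendsto_qParam_one_mul_atImInfty {a : ℝ} (ha : 0 < a) :
    Tendsto (fun τ : ℍ ↦ Periodic.qParam 1 ((a : ℂ) * τ)) atImInfty (𝓝 0) := by
  rw [tendsto_zero_iff_norm_tendsto_zero]
  have h : ∀ τ : ℍ, ‖Periodic.qParam 1 ((a : ℂ) * τ)‖ = Real.exp (-(2 * π * a) * τ.im) :=
      fun τ ↦ by
    rw [Periodic.norm_qParam]
    simp only [mul_im, ofReal_re, coe_im, ofReal_im, coe_re, zero_mul, add_zero, div_one]
    congr 1
    ring
  simp_rw [h]
  exact Real.tendsto_exp_atBot.comp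
    ((tendsto_comap (f := UpperHalfPlane.im)).const_mul_atTop_of_neg (by nlinarith [Real.pi_pos]))

/-- **`η(aτ)/e^{2πi aτ/24} = ∏_{n ≥ 1}(1 - e^{2πi n aτ}) → 1` as `Im τ → ∞`** (`a > 0`).
[folklore] -/
theorem tendsto_eta_tprod_mul_atImInfty {a : ℝ} (ha : 0 < a) :
    Tendsto (fun τ : ℍ ↦ ∏' n : ℕ, (1 - eta_q n ((a : ℂ) * τ))) atImInfty (𝓝 1) := by
  have := tendsto_tprod_one_sub_pow_nhds_zero.comp (tendsto_qParam_one_mul_atImInfty ha)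
  exact this.congr fun τ ↦ by simp [eta_q]

/-- `η(z) = e^{2πi z/24} ∏_{n ≥ 1}(1 - e^{2πi n z})` (Mathlib's definition, restated).
[folklore] -/
theorem eta_eq_qParam_mul_tprod (z : ℂ) :
    η z = Periodic.qParam 24 z * ∏' n : ℕ, (1 - eta_q n z) := rfl

/-! ### Level `22`: the two oldforms `η(τ)²η(11τ)²`, `η(2τ)²η(22τ)²` and `dim S₂(Γ₀(22)) = 2` -/

/-- `M ∣ N → Γ₀(N) ≤ Γ₀(M)`. [folklore] -/
theorem gamma0_le_gamma0_of_dvd {M N : ℕ} (h : M ∣ N) : Gamma0 N ≤ Gamma0 M := by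
  intro γ hγ
  rw [Gamma0_mem] at hγ ⊢
  rw [ZMod.intCast_zmod_eq_zero_iff_dvd] at hγ ⊢
  exact (Int.natCast_dvd_natCast.mpr h).trans hγ

/-- **`φ_11 = η(τ)²η(11τ)²` as a cusp form of level `22`** (the oldform `ι_1 φ_11`,
Diamond–Shurman §5.6): `Γ₀(22) ≤ Γ₀(11)`-invariance, holomorphy and vanishing at all cusps as
for level `11`. [folklore] -/
def cuspFormEtaProductElevenLevel22 : CuspForm (Gamma0 22) 2 where
  toFun := etaProductEleven
  slash_action_eq' A hA := by
    obtain ⟨γ, hγ, rfl⟩ := hA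
    exact etaProductEleven_slash_of_mem (gamma0_le_gamma0_of_dvd (by norm_num) hγ)
  holo' := (mdifferentiable_etaSq.slash _ _).mul (mdifferentiable_etaSq.slash _ _)
  zero_at_cusps' hc := by
    rw [Subgroup.IsArithmetic.isCusp_iff_isCusp_SL2Z] at hc
    rw [OnePoint.isZeroAt_iff_forall_SL2Z hc]
    intro γ _
    have hmul := mul_slash_SL2 1 1 γ (etaSq ∣[(1 : ℤ)] tpD 1) (etaSq ∣[(1 : ℤ)] tpD 11)
    rw [show (1 : ℤ) + 1 = 2 by norm_num, SL_slash, SL_slash, SL_slash] at hmul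
    change IsZeroAtImInfty (etaProductEleven ∣[(2 : ℤ)] (γ : GL (Fin 2) ℝ))
    rw [etaProductEleven, hmul]
    have h := (isZeroAtImInfty_etaSq_slash_tpD_slash 1 γ).mul
      (isZeroAtImInfty_etaSq_slash_tpD_slash 11 γ)
    simp only [mul_zero] at h
    exact h

/-- The underlying function of `ι_1 φ_11`. [folklore] -/
theorem coe_cuspFormEtaProductElevenLevel22 :
    (cuspFormEtaProductElevenLevel22 : ℍ → ℂ) = etaProductEleven := rfl

/-- The exponent identity for `η(2τ)²η(22τ)²` under `Γ₀(22)`, modulo `4` (`decide`). [folklore] -/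
theorem etaProductTwentyTwo_exp_mod_four : ∀ p q k s : ZMod 4, p * s - q * (22 * k) = 1 →
    ((1 - (11 * k) ^ 2) * ((2 * q) * s + 3 * ((11 * k) - 1) * s + (11 * k) + 3) +
        (11 * k) * (p + s - 3)) +
      ((1 - (1 * k) ^ 2) * ((22 * q) * s + 3 * ((1 * k) - 1) * s + (1 * k) + 3) +
        (1 * k) * (p + s - 3)) = 0 := by
  decide

/-- The exponent identity for `η(2τ)²η(22τ)²` under `Γ₀(22)`, modulo `3` (`decide`). [folklore] -/
theorem etaProductTwentyTwo_exp_mod_three : ∀ p q k s : ZMod 3, p * s - q * (22 * k) = 1 →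
    ((1 - (11 * k) ^ 2) * ((2 * q) * s + 3 * ((11 * k) - 1) * s + (11 * k) + 3) +
        (11 * k) * (p + s - 3)) +
      ((1 - (1 * k) ^ 2) * ((22 * q) * s + 3 * ((1 * k) - 1) * s + (1 * k) + 3) +
        (1 * k) * (p + s - 3)) = 0 := by
  decide

/-- **`e(γ_2) + e(γ_22) ≡ 0 (mod 12)` for `γ = (p q; 22k s) ∈ Γ₀(22)`**, where
`γ_a = D_aγD_a⁻¹`: the multipliers of `η(2τ)²` and `η(22τ)²` cancel. [folklore] -/
theorem twelve_dvd_etaProductTwentyTwo_exp {p q k s : ℤ} (h : p * s - q * (22 * k) = 1) :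
    (12 : ℤ) ∣ etaSqExp p (2 * q) (11 * k) s + etaSqExp p (22 * q) (1 * k) s := by
  have h4 : (4 : ℤ) ∣ etaSqExp p (2 * q) (11 * k) s + etaSqExp p (22 * q) (1 * k) s := by
    have hz : ((etaSqExp p (2 * q) (11 * k) s + etaSqExp p (22 * q) (1 * k) s : ℤ) :
        ZMod 4) = 0 := by
      have := etaProductTwentyTwo_exp_mod_four p q k s
        (by exact_mod_cast congrArg (Int.cast : ℤ → ZMod 4) h)
      simp only [etaSqExp]
      push_cast
      linear_combination this
    exact_mod_cast (ZMod.intCast_zmod_eq_zero_iff_dvd _ 4).mp hz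
  have h3 : (3 : ℤ) ∣ etaSqExp p (2 * q) (11 * k) s + etaSqExp p (22 * q) (1 * k) s := by
    have hz : ((etaSqExp p (2 * q) (11 * k) s + etaSqExp p (22 * q) (1 * k) s : ℤ) :
        ZMod 3) = 0 := by
      have := etaProductTwentyTwo_exp_mod_three p q k s
        (by exact_mod_cast congrArg (Int.cast : ℤ → ZMod 3) h)
      simp only [etaSqExp]
      push_cast
      linear_combination this
    exact_mod_cast (ZMod.intCast_zmod_eq_zero_iff_dvd _ 3).mp hz
  omega

/-- `φ_11(2τ) = η(2τ)²η(22τ)²`, as `(η²|₁D_2)(η²|₁D_22)` (the oldform `ι_2 φ_11` of level `22`,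
up to the normalisation of `ι_2`; Diamond–Shurman §5.6). [folklore] -/
def etaProductTwentyTwo : ℍ → ℂ :=
  (etaSq ∣[(1 : ℤ)] tpD 2) * (etaSq ∣[(1 : ℤ)] tpD 22)

/-- `η(2τ)²η(22τ)²`, pointwise. [folklore] -/
theorem etaProductTwentyTwo_apply (τ : ℍ) :
    etaProductTwentyTwo τ = η (2 * τ) ^ 2 * η (22 * τ) ^ 2 := by
  rw [etaProductTwentyTwo, Pi.mul_apply]
  simp only [etaSq_slash_tpD_apply]
  push_cast
  ring_nf

/-- **`η(2τ)²η(22τ)²` is `Γ₀(22)`-invariant in weight `2`**: by the multiplier formula for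
`η²`, the total exponent `e(γ_2) + e(γ_22)` is `≡ 0 (mod 12)`. [folklore] -/
theorem etaProductTwentyTwo_slash_of_mem {γ : SL(2, ℤ)} (hγ : γ ∈ Gamma0 22) :
    etaProductTwentyTwo ∣[(2 : ℤ)] γ = etaProductTwentyTwo := by
  rw [Gamma0_mem] at hγ
  obtain ⟨k, hk⟩ := (ZMod.intCast_zmod_eq_zero_iff_dvd _ 22).mp hγ
  have hdet : γ 0 0 * γ 1 1 - γ 0 1 * γ 1 0 = 1 := by
    have := Matrix.det_fin_two (γ : Matrix (Fin 2) (Fin 2) ℤ)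
    rw [γ.det_coe] at this
    linarith
  have hA : γ 1 0 = ((2 : ℕ) : ℤ) * (11 * k) := by rw [hk]; push_cast; ring
  have hB : γ 1 0 = ((22 : ℕ) : ℤ) * (1 * k) := by rw [hk]; push_cast; ring
  have hmul := mul_slash_SL2 1 1 γ (etaSq ∣[(1 : ℤ)] tpD 2) (etaSq ∣[(1 : ℤ)] tpD 22)
  rw [show (1 : ℤ) + 1 = 2 by norm_num] at hmul
  rw [etaProductTwentyTwo, hmul, SL_slash (f := etaSq ∣[(1 : ℤ)] tpD 2),
    SL_slash (f := etaSq ∣[(1 : ℤ)] tpD 22), etaSq_slash_tpD_slash 2 hA,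
    etaSq_slash_tpD_slash 22 hB, smul_mul_smul_comm, ← Complex.exp_add, ← mul_add]
  simp only [Nat.cast_ofNat]
  obtain ⟨m, hm⟩ :=
    twelve_dvd_etaProductTwentyTwo_exp (p := γ 0 0) (q := γ 0 1) (k := k) (s := γ 1 1)
    (by have h' := hdet; rw [hk] at h'; push_cast at h'; linarith)
  have hm' : (etaSqExp (γ 0 0) (2 * γ 0 1) (11 * k) (γ 1 1) : ℂ) +
      (etaSqExp (γ 0 0) (22 * γ 0 1) (1 * k) (γ 1 1) : ℂ) = 12 * m := by exact_mod_cast hm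
  rw [hm', show (π * I / 6 * (12 * (m : ℂ)) : ℂ) = m * (2 * π * I) by ring,
    Complex.exp_int_mul_two_pi_mul_I, one_smul]

/-- **The cusp form `η(2τ)²η(22τ)² ∈ S₂(Γ₀(22))`.** [folklore] -/
def cuspFormEtaProductTwentyTwo : CuspForm (Gamma0 22) 2 where
  toFun := etaProductTwentyTwo
  slash_action_eq' A hA := by
    obtain ⟨γ, hγ, rfl⟩ := hA
    exact etaProductTwentyTwo_slash_of_mem hγ
  holo' := (mdifferentiable_etaSq.slash _ _).mul (mdifferentiable_etaSq.slash _ _)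
  zero_at_cusps' hc := by
    rw [Subgroup.IsArithmetic.isCusp_iff_isCusp_SL2Z] at hc
    rw [OnePoint.isZeroAt_iff_forall_SL2Z hc]
    intro γ _
    have hmul := mul_slash_SL2 1 1 γ (etaSq ∣[(1 : ℤ)] tpD 2) (etaSq ∣[(1 : ℤ)] tpD 22)
    rw [show (1 : ℤ) + 1 = 2 by norm_num, SL_slash, SL_slash, SL_slash] at hmul
    change IsZeroAtImInfty (etaProductTwentyTwo ∣[(2 : ℤ)] (γ : GL (Fin 2) ℝ))
    rw [etaProductTwentyTwo, hmul]
    have h := (isZeroAtImInfty_etaSq_slash_tpD_slash 2 γ).mul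
      (isZeroAtImInfty_etaSq_slash_tpD_slash 22 γ)
    simp only [mul_zero] at h
    exact h

/-- The underlying function of the cusp form `η(2τ)²η(22τ)²`. [folklore] -/
theorem coe_cuspFormEtaProductTwentyTwo :
    (cuspFormEtaProductTwentyTwo : ℍ → ℂ) = etaProductTwentyTwo := rfl

/-- `η(2τ)²η(22τ)² ≠ 0` (at `τ = i`, since `η` has no zeros on `ℍ`). [folklore] -/
theorem etaProductTwentyTwo_I_ne_zero : etaProductTwentyTwo UpperHalfPlane.I ≠ 0 := by
  rw [etaProductTwentyTwo, Pi.mul_apply]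
  exact mul_ne_zero (etaSq_slash_tpD_ne_zero _ _) (etaSq_slash_tpD_ne_zero _ _)

/-- **Leading terms**: `η(τ)²η(11τ)² / e^{2πiτ} → 1` as `Im τ → ∞` (`φ_11 = q + O(q²)`).
[folklore] -/
theorem tendsto_etaProductEleven_div_qParam :
    Tendsto (fun τ : ℍ ↦ etaProductEleven τ / Periodic.qParam 1 τ) atImInfty (𝓝 1) := by
  have h := ((tendsto_eta_tprod_mul_atImInfty one_pos).pow 2).mul
    ((tendsto_eta_tprod_mul_atImInfty (a := 11) (by norm_num)).pow 2)
  rw [one_pow, one_mul] at h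
  refine h.congr fun τ ↦ ?_
  rw [etaProductEleven_apply, eta_eq_qParam_mul_tprod, eta_eq_qParam_mul_tprod]
  have hq : Periodic.qParam 24 (τ : ℂ) ^ 2 * Periodic.qParam 24 (11 * (τ : ℂ)) ^ 2 =
      Periodic.qParam 1 τ := by
    simp only [Periodic.qParam]
    rw [← Complex.exp_nat_mul, ← Complex.exp_nat_mul, ← Complex.exp_add]
    congr 1
    push_cast
    ring
  rw [eq_div_iff (Periodic.qParam_ne_zero _), ← hq]
  push_cast
  ring

/-- **Leading terms**: `η(2τ)²η(22τ)² / e^{2πiτ} → 0` as `Im τ → ∞` (`ι_2 φ_11 = q² + O(q³)`).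
[folklore] -/
theorem tendsto_etaProductTwentyTwo_div_qParam :
    Tendsto (fun τ : ℍ ↦ etaProductTwentyTwo τ / Periodic.qParam 1 τ) atImInfty (𝓝 0) := by
  have h := ((tendsto_qParam_one_mul_atImInfty one_pos).mul
    ((tendsto_eta_tprod_mul_atImInfty (a := 2) (by norm_num)).pow 2)).mul
    ((tendsto_eta_tprod_mul_atImInfty (a := 22) (by norm_num)).pow 2)
  rw [zero_mul, zero_mul] at h
  refine h.congr fun τ ↦ ?_
  rw [etaProductTwentyTwo_apply, eta_eq_qParam_mul_tprod, eta_eq_qParam_mul_tprod]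
  have hq : Periodic.qParam 24 (2 * (τ : ℂ)) ^ 2 * Periodic.qParam 24 (22 * (τ : ℂ)) ^ 2 =
      Periodic.qParam 1 τ * Periodic.qParam 1 ((1 : ℝ) * τ) := by
    simp only [Periodic.qParam]
    rw [← Complex.exp_nat_mul, ← Complex.exp_nat_mul, ← Complex.exp_add, ← Complex.exp_add]
    congr 1
    push_cast
    ring
  rw [eq_div_iff (Periodic.qParam_ne_zero _)]
  have : Periodic.qParam 1 ((1 : ℝ) * (τ : ℂ)) *
      (∏' n : ℕ, (1 - eta_q n ((2 : ℝ) * (τ : ℂ)))) ^ 2 *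
      (∏' n : ℕ, (1 - eta_q n ((22 : ℝ) * (τ : ℂ)))) ^ 2 * Periodic.qParam 1 τ =
      (Periodic.qParam 1 τ * Periodic.qParam 1 ((1 : ℝ) * τ)) *
      ((∏' n : ℕ, (1 - eta_q n (2 * (τ : ℂ)))) ^ 2 *
      (∏' n : ℕ, (1 - eta_q n (22 * (τ : ℂ)))) ^ 2) := by push_cast; ring
  rw [this, ← hq]
  ring

/-- **`ι_1 φ_11` and `ι_2 φ_11` are linearly independent in `S₂(Γ₀(22))`** (leading terms `q` and
`q²`). [folklore] -/
theorem linearIndependent_etaProducts_level22 :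
    LinearIndependent ℂ ![cuspFormEtaProductElevenLevel22, cuspFormEtaProductTwentyTwo] := by
  rw [LinearIndependent.pair_iff]
  intro s t hst
  have h : ∀ τ : ℍ, s * etaProductEleven τ + t * etaProductTwentyTwo τ = 0 := fun τ ↦ by
    have := congrArg (fun f : CuspForm (Gamma0 22) 2 ↦ f τ) hst
    simp only [CuspForm.add_apply, CuspForm.zero_apply] at this
    exact this
  have hs : s = 0 := by
    have hlim : Tendsto (fun τ : ℍ ↦ s * (etaProductEleven τ / Periodic.qParam 1 τ) +
        t * (etaProductTwentyTwo τ / Periodic.qParam 1 τ)) atImInfty (𝓝 (s * 1 + t * 0)) :=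
      (tendsto_etaProductEleven_div_qParam.const_mul s).add
        (tendsto_etaProductTwentyTwo_div_qParam.const_mul t)
    have hzero : (fun τ : ℍ ↦ s * (etaProductEleven τ / Periodic.qParam 1 τ) +
        t * (etaProductTwentyTwo τ / Periodic.qParam 1 τ)) = fun _ ↦ 0 := by
      funext τ
      rw [mul_div_assoc', mul_div_assoc', ← add_div, h τ, zero_div]
    rw [hzero, mul_one, mul_zero, add_zero] at hlim
    exact (tendsto_const_nhds_iff.mp hlim).symm
  subst hs
  have ht : t * etaProductTwentyTwo UpperHalfPlane.I = 0 := by simpa using h UpperHalfPlane.I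
  exact ⟨rfl, (mul_eq_zero.mp ht).resolve_right etaProductTwentyTwo_I_ne_zero⟩

/-- `μ(Γ₀(22)) = 36`, `ν_∞(Γ₀(22)) = 4`, `ν₂(Γ₀(22)) = 0`, `ν₃(Γ₀(22)) = 0`, so
`g(X₀(22)) = (12 + 36 - 24)/12 = 2`. [folklore] -/
theorem gamma0_data_22 :
    gamma0Index 22 = 36 ∧ nuInfty 22 = 4 ∧ nu₂ 22 = 0 ∧ nu₃ 22 = 0 :=
  ⟨(gamma0Index_mul (m := 2) (n := 11) (by norm_num)).trans
      (by rw [gamma0Index_prime Nat.prime_two, gamma0Index_prime (by norm_num)]),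
    by decide, by rw [nu₂_eq_card]; decide, by rw [nu₃_eq_card]; decide⟩

/-- `g(X₀(22)) = 2`. [folklore] -/
theorem genusX0_twentyTwo : genusX0 22 = 2 := by
  obtain ⟨hμ, hν, h₂, h₃⟩ := gamma0_data_22
  rw [genusX0, hμ, hν, h₂, h₃]

/-- **`dim S₂(Γ₀(22)) = g(X₀(22)) = 2`** — the first instance of genus `≥ 2` of the named fact
`finrank_cuspForm_two_eq_genusX0` (Diamond–Shurman Thm. 3.5.1), unconditionally: `≤` is Manin's
bound (`finrank_cuspForm_two_le_genusX0`), `≥` the two independent oldforms `η(τ)²η(11τ)²`,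
`η(2τ)²η(22τ)²`; and these two span `S₂(Γ₀(22))` (there are no newforms of level `22`).
[cite: DiamondShurman2005, Thm. 3.5.1] -/
theorem finrank_cuspForm_two_eq_genusX0_twentyTwo :
    finrank_cuspForm_two_eq_genusX0 22 ∧ Module.finrank ℂ (CuspForm (Gamma0 22) 2) = 2 ∧
      ⊤ ≤ Submodule.span ℂ
        (Set.range ![cuspFormEtaProductElevenLevel22, cuspFormEtaProductTwentyTwo]) := by
  have hfd : FiniteDimensional ℂ (CuspForm (Gamma0 22) 2) := finiteDimensional_cuspForm_gamma0 22 2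
  have hle : Module.finrank ℂ (CuspForm (Gamma0 22) 2) ≤ 2 :=
    (finrank_cuspForm_two_le_genusX0 22).trans_eq genusX0_twentyTwo
  have hge : 2 ≤ Module.finrank ℂ (CuspForm (Gamma0 22) 2) := by
    simpa using linearIndependent_etaProducts_level22.fintype_card_le_finrank
  have h2 : Module.finrank ℂ (CuspForm (Gamma0 22) 2) = 2 := le_antisymm hle hge
  refine ⟨by rw [finrank_cuspForm_two_eq_genusX0, h2, genusX0_twentyTwo], h2, ?_⟩
  have hb := linearIndependent_etaProducts_level22.span_eq_top_of_card_eq_finrank' (by simp [h2])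
  exact hb.ge

/-! ### Level `23`: `φ_23 = η(τ)²η(23τ)²`, its Hecke translate `T₂ φ_23`, and
`dim S₂(Γ₀(23)) = 2` -/

/-- The exponent identity for `η(τ)²η(23τ)²` under `Γ₀(23)`, modulo `4` (`decide`). [folklore] -/
theorem etaProductTwentyThree_exp_mod_four : ∀ p q k s : ZMod 4, p * s - q * (23 * k) = 1 →
    ((1 - (23 * k) ^ 2) * ((1 * q) * s + 3 * ((23 * k) - 1) * s + (23 * k) + 3) +
        (23 * k) * (p + s - 3)) +
      ((1 - (1 * k) ^ 2) * ((23 * q) * s + 3 * ((1 * k) - 1) * s + (1 * k) + 3) +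
        (1 * k) * (p + s - 3)) = 0 := by
  decide

/-- The exponent identity for `η(τ)²η(23τ)²` under `Γ₀(23)`, modulo `3` (`decide`). [folklore] -/
theorem etaProductTwentyThree_exp_mod_three : ∀ p q k s : ZMod 3, p * s - q * (23 * k) = 1 →
    ((1 - (23 * k) ^ 2) * ((1 * q) * s + 3 * ((23 * k) - 1) * s + (23 * k) + 3) +
        (23 * k) * (p + s - 3)) +
      ((1 - (1 * k) ^ 2) * ((23 * q) * s + 3 * ((1 * k) - 1) * s + (1 * k) + 3) +
        (1 * k) * (p + s - 3)) = 0 := by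
  decide

/-- **`e(γ_1) + e(γ_23) ≡ 0 (mod 12)` for `γ = (p q; 23k s) ∈ Γ₀(23)`**: the multipliers of
`η(τ)²` and `η(23τ)²` cancel (the classical criterion: `1·2 + 23·2 ≡ 0`, `23·2 + 1·2 ≡ 0 (mod 24)`,
`1²·23²` a square). [folklore] -/
theorem twelve_dvd_etaProductTwentyThree_exp {p q k s : ℤ} (h : p * s - q * (23 * k) = 1) :
    (12 : ℤ) ∣ etaSqExp p (1 * q) (23 * k) s + etaSqExp p (23 * q) (1 * k) s := by
  have h4 : (4 : ℤ) ∣ etaSqExp p (1 * q) (23 * k) s + etaSqExp p (23 * q) (1 * k) s := by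
    have hz : ((etaSqExp p (1 * q) (23 * k) s + etaSqExp p (23 * q) (1 * k) s : ℤ) :
        ZMod 4) = 0 := by
      have := etaProductTwentyThree_exp_mod_four p q k s
        (by exact_mod_cast congrArg (Int.cast : ℤ → ZMod 4) h)
      simp only [etaSqExp]
      push_cast
      linear_combination this
    exact_mod_cast (ZMod.intCast_zmod_eq_zero_iff_dvd _ 4).mp hz
  have h3 : (3 : ℤ) ∣ etaSqExp p (1 * q) (23 * k) s + etaSqExp p (23 * q) (1 * k) s := by
    have hz : ((etaSqExp p (1 * q) (23 * k) s + etaSqExp p (23 * q) (1 * k) s : ℤ) :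
        ZMod 3) = 0 := by
      have := etaProductTwentyThree_exp_mod_three p q k s
        (by exact_mod_cast congrArg (Int.cast : ℤ → ZMod 3) h)
      simp only [etaSqExp]
      push_cast
      linear_combination this
    exact_mod_cast (ZMod.intCast_zmod_eq_zero_iff_dvd _ 3).mp hz
  omega

/-- `φ_23(τ) = η(τ)²η(23τ)²`, as `(η²|₁D_1)(η²|₁D_23)` — the square of the weight-one form
`η(τ)η(23τ)` of level `23`. [folklore] -/
def etaProductTwentyThree : ℍ → ℂ :=
  (etaSq ∣[(1 : ℤ)] tpD 1) * (etaSq ∣[(1 : ℤ)] tpD 23)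

/-- `φ_23(τ) = η(τ)²η(23τ)²`, pointwise. [folklore] -/
theorem etaProductTwentyThree_apply (τ : ℍ) :
    etaProductTwentyThree τ = η τ ^ 2 * η (23 * τ) ^ 2 := by
  rw [etaProductTwentyThree, Pi.mul_apply]
  simp only [etaSq_slash_tpD_apply]
  push_cast
  ring_nf

/-- `φ_23` has no zeros on `ℍ`. [folklore] -/
theorem etaProductTwentyThree_ne_zero (τ : ℍ) : etaProductTwentyThree τ ≠ 0 := by
  rw [etaProductTwentyThree, Pi.mul_apply]
  exact mul_ne_zero (etaSq_slash_tpD_ne_zero _ _) (etaSq_slash_tpD_ne_zero _ _)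

/-- **`φ_23 = η(τ)²η(23τ)²` is `Γ₀(23)`-invariant in weight `2`.** [folklore] -/
theorem etaProductTwentyThree_slash_of_mem {γ : SL(2, ℤ)} (hγ : γ ∈ Gamma0 23) :
    etaProductTwentyThree ∣[(2 : ℤ)] γ = etaProductTwentyThree := by
  rw [Gamma0_mem] at hγ
  obtain ⟨k, hk⟩ := (ZMod.intCast_zmod_eq_zero_iff_dvd _ 23).mp hγ
  have hdet : γ 0 0 * γ 1 1 - γ 0 1 * γ 1 0 = 1 := by
    have := Matrix.det_fin_two (γ : Matrix (Fin 2) (Fin 2) ℤ)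
    rw [γ.det_coe] at this
    linarith
  have hA : γ 1 0 = ((1 : ℕ) : ℤ) * (23 * k) := by rw [hk]; push_cast; ring
  have hB : γ 1 0 = ((23 : ℕ) : ℤ) * (1 * k) := by rw [hk]; push_cast; ring
  have hmul := mul_slash_SL2 1 1 γ (etaSq ∣[(1 : ℤ)] tpD 1) (etaSq ∣[(1 : ℤ)] tpD 23)
  rw [show (1 : ℤ) + 1 = 2 by norm_num] at hmul
  rw [etaProductTwentyThree, hmul, SL_slash (f := etaSq ∣[(1 : ℤ)] tpD 1),
    SL_slash (f := etaSq ∣[(1 : ℤ)] tpD 23), etaSq_slash_tpD_slash 1 hA,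
    etaSq_slash_tpD_slash 23 hB, smul_mul_smul_comm, ← Complex.exp_add, ← mul_add]
  simp only [Nat.cast_ofNat, Nat.cast_one]
  obtain ⟨m, hm⟩ :=
    twelve_dvd_etaProductTwentyThree_exp (p := γ 0 0) (q := γ 0 1) (k := k) (s := γ 1 1)
    (by have h' := hdet; rw [hk] at h'; push_cast at h'; linarith)
  have hm' : (etaSqExp (γ 0 0) (1 * γ 0 1) (23 * k) (γ 1 1) : ℂ) +
      (etaSqExp (γ 0 0) (23 * γ 0 1) (1 * k) (γ 1 1) : ℂ) = 12 * m := by exact_mod_cast hm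
  rw [hm', show (π * I / 6 * (12 * (m : ℂ)) : ℂ) = m * (2 * π * I) by ring,
    Complex.exp_int_mul_two_pi_mul_I, one_smul]

/-- **The cusp form `φ_23 = η(τ)²η(23τ)² ∈ S₂(Γ₀(23))`.** [folklore] -/
def cuspFormEtaProductTwentyThree : CuspForm (Gamma0 23) 2 where
  toFun := etaProductTwentyThree
  slash_action_eq' A hA := by
    obtain ⟨γ, hγ, rfl⟩ := hA
    exact etaProductTwentyThree_slash_of_mem hγ
  holo' := (mdifferentiable_etaSq.slash _ _).mul (mdifferentiable_etaSq.slash _ _)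
  zero_at_cusps' hc := by
    rw [Subgroup.IsArithmetic.isCusp_iff_isCusp_SL2Z] at hc
    rw [OnePoint.isZeroAt_iff_forall_SL2Z hc]
    intro γ _
    have hmul := mul_slash_SL2 1 1 γ (etaSq ∣[(1 : ℤ)] tpD 1) (etaSq ∣[(1 : ℤ)] tpD 23)
    rw [show (1 : ℤ) + 1 = 2 by norm_num, SL_slash, SL_slash, SL_slash] at hmul
    change IsZeroAtImInfty (etaProductTwentyThree ∣[(2 : ℤ)] (γ : GL (Fin 2) ℝ))
    rw [etaProductTwentyThree, hmul]
    have h := (isZeroAtImInfty_etaSq_slash_tpD_slash 1 γ).mul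
      (isZeroAtImInfty_etaSq_slash_tpD_slash 23 γ)
    simp only [mul_zero] at h
    exact h

/-- The underlying function of the cusp form `φ_23`. [folklore] -/
theorem coe_cuspFormEtaProductTwentyThree :
    (cuspFormEtaProductTwentyThree : ℍ → ℂ) = etaProductTwentyThree := rfl

/-- **Leading term `φ_23 = q² + O(q³)`**: `φ_23(τ)/e^{4πiτ} → 1` as `Im τ → ∞`. [folklore] -/
theorem tendsto_etaProductTwentyThree_div_qParam_sq :
    Tendsto (fun τ : ℍ ↦ etaProductTwentyThree τ / Periodic.qParam 1 τ ^ 2) atImInfty (𝓝 1) := by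
  have h := ((tendsto_eta_tprod_mul_atImInfty one_pos).pow 2).mul
    ((tendsto_eta_tprod_mul_atImInfty (a := 23) (by norm_num)).pow 2)
  rw [one_pow, one_mul] at h
  refine h.congr fun τ ↦ ?_
  rw [etaProductTwentyThree_apply, eta_eq_qParam_mul_tprod, eta_eq_qParam_mul_tprod]
  have hq : Periodic.qParam 24 (τ : ℂ) ^ 2 * Periodic.qParam 24 (23 * (τ : ℂ)) ^ 2 =
      Periodic.qParam 1 τ ^ 2 := by
    simp only [Periodic.qParam]
    rw [← Complex.exp_nat_mul, ← Complex.exp_nat_mul, ← Complex.exp_nat_mul, ← Complex.exp_add]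
    congr 1
    push_cast
    ring
  rw [eq_div_iff (pow_ne_zero _ (Periodic.qParam_ne_zero _)), ← hq]
  push_cast
  ring

/-- `φ_23(τ)/e^{2πiτ} → 0` as `Im τ → ∞` (`a_1(φ_23) = 0`). [folklore] -/
theorem tendsto_etaProductTwentyThree_div_qParam :
    Tendsto (fun τ : ℍ ↦ etaProductTwentyThree τ / Periodic.qParam 1 τ) atImInfty (𝓝 0) := by
  have h :=
    tendsto_etaProductTwentyThree_div_qParam_sq.mul (tendsto_qParam_one_mul_atImInfty one_pos)
  rw [mul_zero] at h
  refine h.congr fun τ ↦ ?_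
  have hq : Periodic.qParam 1 (((1 : ℝ) : ℂ) * (τ : ℂ)) = Periodic.qParam 1 τ := by
    push_cast; rw [one_mul]
  rw [hq]
  field_simp [Periodic.qParam_ne_zero (τ : ℂ)]

/-- `(1 j; 0 2)` fixes `∞`. [folklore] -/
theorem tpB_two_apply_one_zero (j : ℤ) : (tpB 2 j : GL (Fin 2) ℝ) 1 0 = 0 := by
  show ((tpB 2 j : GL (Fin 2) ℝ) : Matrix (Fin 2) (Fin 2) ℝ) 1 0 = 0
  rw [val_tpB]
  rfl

/-- `diag(2, 1)` fixes `∞`. [folklore] -/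
theorem tpD_two_apply_one_zero : (tpD 2 : GL (Fin 2) ℝ) 1 0 = 0 := by
  show ((tpD 2 : GL (Fin 2) ℝ) : Matrix (Fin 2) (Fin 2) ℝ) 1 0 = 0
  rw [val_tpD]
  rfl

/-- The Hecke pieces `φ_23((τ + j)/2)/e^{2πiτ} → 1` as `Im τ → ∞` (`q((τ + j)/2)² = q(τ)`).
[folklore] -/
theorem tendsto_etaProductTwentyThree_tpB_div_qParam (j : ℤ) :
    Tendsto (fun τ : ℍ ↦ etaProductTwentyThree (tpB 2 j • τ) / Periodic.qParam 1 τ) atImInfty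
      (𝓝 1) := by
  have h := tendsto_etaProductTwentyThree_div_qParam_sq.comp
    (tendsto_smul_atImInfty (tpB_two_apply_one_zero j))
  refine h.congr fun τ ↦ ?_
  simp only [Function.comp_apply]
  rw [qParam_tpB_smul_pow 2 j τ 2]
  have h1 : ζp 2 ^ ((2 : ℕ) * j : ℤ) = 1 := by
    rw [zpow_mul, show (ζp 2) ^ ((2 : ℕ) : ℤ) = 1 from ?_, one_zpow]
    rw [zpow_natCast, ζp, ← Complex.exp_nat_mul]
    push_cast
    rw [show (2 : ℂ) * (2 * π * I / 2) = 2 * π * I by ring, Complex.exp_two_pi_mul_I]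
  rw [h1, mul_one]
  congr 1
  simp only [Periodic.qParam]
  congr 1
  push_cast
  ring

/-- The Hecke piece `φ_23(2τ)/e^{2πiτ} → 0` as `Im τ → ∞` (`φ_23(2τ) = q⁴ + O(q⁵)`). [folklore] -/
theorem tendsto_etaProductTwentyThree_tpD_div_qParam :
    Tendsto (fun τ : ℍ ↦ etaProductTwentyThree (tpD 2 • τ) / Periodic.qParam 1 τ) atImInfty
      (𝓝 0) := by
  have h := (tendsto_etaProductTwentyThree_div_qParam_sq.comp
    (tendsto_smul_atImInfty tpD_two_apply_one_zero)).mul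
    ((tendsto_qParam_one_mul_atImInfty one_pos).pow 3)
  rw [zero_pow three_ne_zero, mul_zero] at h
  refine h.congr fun τ ↦ ?_
  simp only [Function.comp_apply]
  rw [qParam_tpD_smul_pow 2 τ 2]
  have hq : Periodic.qParam 1 (((1 : ℝ) : ℂ) * (τ : ℂ)) = Periodic.qParam 1 τ := by
    push_cast; rw [one_mul]
  rw [hq]
  field_simp [Periodic.qParam_ne_zero (τ : ℂ)]

/-- **`T₂ φ_23` pointwise** (Diamond–Shurman Prop. 5.2.1 for `Γ₀(23)`, `2 ∤ 23`):
`(T₂ φ_23)(τ) = ½ φ_23(τ/2) + ½ φ_23((τ+1)/2) + 2 φ_23(2τ)`.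
[cite: DiamondShurman2005, Prop. 5.2.1] -/
theorem heckeT_two_etaProductTwentyThree_apply (τ : ℍ) :
    heckeT (Gamma0 23) 2 2 cuspFormEtaProductTwentyThree τ =
      (2 : ℂ)⁻¹ * etaProductTwentyThree (tpB 2 0 • τ) +
        (2 : ℂ)⁻¹ * etaProductTwentyThree (tpB 2 1 • τ) +
        2 * etaProductTwentyThree (tpD 2 • τ) := by
  have h := congrFun (coe_heckeT_gamma0_eq_sum 23 2 2 Nat.prime_two cuspFormEtaProductTwentyThree) τ
  rw [h, if_neg (by norm_num : ¬ (2 ∣ 23)), Pi.add_apply, Finset.sum_apply, Fin.sum_univ_two,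
    slash_tpB_apply, slash_tpB_apply, slash_tpD_apply, coe_cuspFormEtaProductTwentyThree]
  simp only [Fin.val_zero, Fin.val_one, Nat.cast_zero, Nat.cast_one, Nat.cast_ofNat]
  norm_num

/-- **Leading term `T₂ φ_23 = q + O(q²)`**: `(T₂ φ_23)(τ)/e^{2πiτ} → ½ + ½ + 0 = 1` (`a_1(T₂φ) =
a_2(φ) = 1`). [folklore] -/
theorem tendsto_heckeT_two_etaProductTwentyThree_div_qParam :
    Tendsto (fun τ : ℍ ↦ heckeT (Gamma0 23) 2 2 cuspFormEtaProductTwentyThree τ /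
      Periodic.qParam 1 τ) atImInfty (𝓝 1) := by
  have h := (((tendsto_etaProductTwentyThree_tpB_div_qParam 0).const_mul (2 : ℂ)⁻¹).add
    ((tendsto_etaProductTwentyThree_tpB_div_qParam 1).const_mul (2 : ℂ)⁻¹)).add
    (tendsto_etaProductTwentyThree_tpD_div_qParam.const_mul 2)
  rw [show ((2 : ℂ)⁻¹ * 1 + (2 : ℂ)⁻¹ * 1 + 2 * 0 : ℂ) = 1 by norm_num] at h
  refine h.congr fun τ ↦ ?_
  rw [heckeT_two_etaProductTwentyThree_apply]
  ring

/-- **`T₂ φ_23` and `φ_23` are linearly independent in `S₂(Γ₀(23))`** (leading terms `q` and `q²`).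
[folklore] -/
theorem linearIndependent_heckeT_etaProduct_level23 :
    LinearIndependent ℂ
      ![heckeT (Gamma0 23) 2 2 cuspFormEtaProductTwentyThree, cuspFormEtaProductTwentyThree] := by
  rw [LinearIndependent.pair_iff]
  intro s t hst
  have h : ∀ τ : ℍ, s * heckeT (Gamma0 23) 2 2 cuspFormEtaProductTwentyThree τ +
      t * etaProductTwentyThree τ = 0 := fun τ ↦ by
    have := congrArg (fun f : CuspForm (Gamma0 23) 2 ↦ f τ) hst
    simp only [CuspForm.add_apply, CuspForm.zero_apply] at this
    exact this
  have hs : s = 0 := by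
    have hlim : Tendsto (fun τ : ℍ ↦
        s * (heckeT (Gamma0 23) 2 2 cuspFormEtaProductTwentyThree τ / Periodic.qParam 1 τ) +
        t * (etaProductTwentyThree τ / Periodic.qParam 1 τ)) atImInfty (𝓝 (s * 1 + t * 0)) :=
      (tendsto_heckeT_two_etaProductTwentyThree_div_qParam.const_mul s).add
        (tendsto_etaProductTwentyThree_div_qParam.const_mul t)
    have hzero : (fun τ : ℍ ↦
        s * (heckeT (Gamma0 23) 2 2 cuspFormEtaProductTwentyThree τ / Periodic.qParam 1 τ) +
        t * (etaProductTwentyThree τ / Periodic.qParam 1 τ)) = fun _ ↦ 0 := by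
      funext τ
      rw [mul_div_assoc', mul_div_assoc', ← add_div, h τ, zero_div]
    rw [hzero, mul_one, mul_zero, add_zero] at hlim
    exact (tendsto_const_nhds_iff.mp hlim).symm
  subst hs
  have ht : t * etaProductTwentyThree UpperHalfPlane.I = 0 := by simpa using h UpperHalfPlane.I
  exact ⟨rfl, (mul_eq_zero.mp ht).resolve_right (etaProductTwentyThree_ne_zero _)⟩

/-- `μ(Γ₀(23)) = 24`, `ν_∞(Γ₀(23)) = 2`, `ν₂(Γ₀(23)) = 0`, `ν₃(Γ₀(23)) = 0`, so
`g(X₀(23)) = (12 + 24 - 12)/12 = 2`. [folklore] -/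
theorem gamma0_data_23 :
    gamma0Index 23 = 24 ∧ nuInfty 23 = 2 ∧ nu₂ 23 = 0 ∧ nu₃ 23 = 0 :=
  ⟨gamma0Index_prime (by norm_num), by decide, by rw [nu₂_eq_card]; decide,
    by rw [nu₃_eq_card]; decide⟩

/-- `g(X₀(23)) = 2`. [folklore] -/
theorem genusX0_twentyThree : genusX0 23 = 2 := by
  obtain ⟨hμ, hν, h₂, h₃⟩ := gamma0_data_23
  rw [genusX0, hμ, hν, h₂, h₃]

/-- **`dim S₂(Γ₀(23)) = g(X₀(23)) = 2`** — the named fact `finrank_cuspForm_two_eq_genusX0` at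
the first prime level of genus `2` (Diamond–Shurman Thm. 3.5.1), unconditionally: `≤` is Manin's
bound, `≥` the independent pair `T₂ φ_23`, `φ_23` with `φ_23 = η(τ)²η(23τ)²`; and
`S₂(Γ₀(23)) = ℂ T₂φ_23 ⊕ ℂ φ_23`. [cite: DiamondShurman2005, Thm. 3.5.1] -/
theorem finrank_cuspForm_two_eq_genusX0_twentyThree :
    finrank_cuspForm_two_eq_genusX0 23 ∧ Module.finrank ℂ (CuspForm (Gamma0 23) 2) = 2 ∧
      ⊤ ≤ Submodule.span ℂ (Set.range
        ![heckeT (Gamma0 23) 2 2 cuspFormEtaProductTwentyThree,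
          cuspFormEtaProductTwentyThree]) := by
  have hfd : FiniteDimensional ℂ (CuspForm (Gamma0 23) 2) := finiteDimensional_cuspForm_gamma0 23 2
  have hle : Module.finrank ℂ (CuspForm (Gamma0 23) 2) ≤ 2 :=
    (finrank_cuspForm_two_le_genusX0 23).trans_eq genusX0_twentyThree
  have hge : 2 ≤ Module.finrank ℂ (CuspForm (Gamma0 23) 2) := by
    simpa using linearIndependent_heckeT_etaProduct_level23.fintype_card_le_finrank
  have h2 : Module.finrank ℂ (CuspForm (Gamma0 23) 2) = 2 := le_antisymm hle hge
  refine ⟨by rw [finrank_cuspForm_two_eq_genusX0, h2, genusX0_twentyThree], h2, ?_⟩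
  have hb :=
    linearIndependent_heckeT_etaProduct_level23.span_eq_top_of_card_eq_finrank' (by simp [h2])
  exact hb.ge

/-! ### The levels at which `dim S₂(Γ₀(N)) = g(X₀(N))` is proved -/

/-- **`dim S₂(Γ₀(N)) = g(X₀(N))` (the named fact `finrank_cuspForm_two_eq_genusX0 N`,
Diamond–Shurman Thm. 3.5.1) holds unconditionally for
`N ∈ {1, …, 13, 16, 18, 20, 22, 23, 25, 27, 32, 36}`**: the genus-zero levels
(`ModularCurveGenusBoundProofs`, Manin's bound), the genus-one levels carrying an `η²`-product
(`ModularCurveEtaProductsProofs`), and `N = 22` (this file).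
[cite: DiamondShurman2005, Thm. 3.5.1] -/
theorem finrank_cuspForm_two_eq_genusX0_of_mem_levels {N : ℕ} [NeZero N]
    (hN : N ∈ ({1, 2, 3, 4, 5, 6, 7, 8, 9, 10, 11, 12, 13, 16, 18, 20, 22, 23, 25, 27, 32, 36} :
      Finset ℕ)) :
    finrank_cuspForm_two_eq_genusX0 N := by
  simp only [Finset.mem_insert, Finset.mem_singleton] at hN
  rcases hN with rfl | rfl | rfl | rfl | rfl | rfl | rfl | rfl | rfl | rfl | rfl | rfl | rfl |
    rfl | rfl | rfl | rfl | rfl | rfl | rfl | rfl | rfl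
  all_goals first
    | exact finrank_cuspForm_two_eq_genusX0_eleven.1
    | exact finrank_cuspForm_two_eq_genusX0_twenty.1
    | exact finrank_cuspForm_two_eq_genusX0_twentyTwo.1
    | exact finrank_cuspForm_two_eq_genusX0_twentyThree.1
    | exact finrank_cuspForm_two_eq_genusX0_twentySeven.1
    | exact finrank_cuspForm_two_eq_genusX0_thirtyTwo.1
    | exact finrank_cuspForm_two_eq_genusX0_thirtySix.1
    | exact finrank_cuspForm_two_eq_genusX0_of_mem' (by decide)

/-- **The genus-cum-dimension formula `twelve_mul_finrank_cuspForm_two (Γ₀(N))`**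
(`12 dim S₂(Γ₀(N)) + 3ε₂ + 4ε₃ + 6ε_∞ = 12 + [SL₂(ℤ) : Γ₀(N)]`, Diamond–Shurman Thm. 3.1.1 with
Thm. 3.5.1; the named fact of `ModularCurveProofs`) **holds for
`N ∈ {1, …, 13, 16, 18, 20, 22, 23, 25, 27, 32, 36}`**, by
`twelve_mul_finrank_cuspForm_two_gamma0_iff`.
[cite: DiamondShurman2005, Thm. 3.1.1] -/
theorem twelve_mul_finrank_cuspForm_two_gamma0_of_mem_levels {N : ℕ} [NeZero N]
    (hN : N ∈ ({1, 2, 3, 4, 5, 6, 7, 8, 9, 10, 11, 12, 13, 16, 18, 20, 22, 23, 25, 27, 32, 36} :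
      Finset ℕ)) :
    twelve_mul_finrank_cuspForm_two (Gamma0 N) :=
  (twelve_mul_finrank_cuspForm_two_gamma0_iff N).mpr
    (finrank_cuspForm_two_eq_genusX0_of_mem_levels hN)

/-- **`Ω⁺_f > 0` and `Ω⁻_f > 0` for rational newforms of level
`N ∈ {1, …, 13, 16, 18, 20, 22, 23, 25, 27, 32, 36}`, given conjugation-stability** — the
Eichler–Shimura-lattice chain of `ModularSymbolsManin` with its dimension hypothesis discharged
(meaningful at `N = 11, 20, 27, 32, 36`, the levels in the list carrying newforms: the elliptic
curves `11a, 20a, 27a, 32a, 36a`). [cite: CremonaAlgorithms1997, §2.8] -/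
theorem IsNewform0.plusPeriod_pos_and_minusPeriod_pos_of_mem_levels {N : ℕ} [NeZero N]
    (hN : N ∈ ({1, 2, 3, 4, 5, 6, 7, 8, 9, 10, 11, 12, 13, 16, 18, 20, 22, 23, 25, 27, 32, 36} :
      Finset ℕ)) {f : CuspForm (Gamma0 N) 2} (H₂ : conj_mem_periodLattice (f := f)) :
    IsNewform0.plusPeriod_pos (f := f) ∧ IsNewform0.minusPeriod_pos (f := f) :=
  IsNewform0.plusPeriod_pos_and_minusPeriod_pos_of_genusX0_le N
    ((finrank_cuspForm_two_eq_genusX0_iff_le N).mp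
      (finrank_cuspForm_two_eq_genusX0_of_mem_levels hN)) H₂

end Literature.NumberTheory.EllipticCurves.ModularForms

end
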